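import Summits.BirchSwinnertonDyer.BirchSwinnertonDyer.Theorems.ClassRecordThreeEulerHalvesAtThreeCartanSupplyCubicClasses
import Summits.BirchSwinnertonDyer.BirchSwinnertonDyer.Theorems.ClassRecordThreeEulerHalvesAtThreeCartanSupplyCubicPointsFixedCount
import HarnessLib

/-!
# The cubic Hecke operator `T` on `ℤ[X]`: equivariance, semilinearity `T ρ_u = ρ_{u⁻¹} T`, degree `q`, and `T² = q` on fibre-sum-zero functions

Helper file `--supports stmt-BirchSwinnertonDyer-23422` (seat `bsd-stepL-tam3-p1` g23, LINE OWNER of crux 23422, line `cartan` v11), serving the registered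
stub (SUPPLY) `stub_cartanTorusLatticeSupply` (memo `HOME/tam3-p1/g23/SUPPLY-ROAD-GG1.md` §2, re-modelled on the cubic classes `X` of `…CubicClasses`).
The HECKE RELATION `rel [v] [w] :⟺ det(v | w) ∈ K` (a non-zero cube; `dt`, `IsCubeUnit`, `rel_mk`) is `G`-invariant (`det(g⋆v | g⋆w) = (det g)³ det(v|w)`,
`rel_σX`), moves scalings across (`rel (ρ_u x) y ↔ rel x (ρ_u y)`) and is symmetric (`−1` is a cube). The HECKE OPERATOR
`(T φ)(x) = Σ_{y : rel x y} φ(y)` on `X → A` (`A` any commutative ring; `hecke`, `hecke_apply`) therefore commutes with the action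
`act g φ = φ ∘ σX g⁻¹` (`hecke_comp_act`) and is SEMILINEAR for the scalings `sc u φ = φ ∘ ρ_{u⁻¹}`: `T ∘ sc u = sc u⁻¹ ∘ T` (`hecke_comp_sc`).
Counting over `𝔽_q²` (`card_dt_eq`, `card_cubeUnits`): every point has exactly `q` Hecke neighbours (`card_rel_eq`, i.e. `T𝟙 = q𝟙`).
Part II (`…CubicHeckeSquare`): `T² = q` on the fibre-sum-zero lattice `V₁ = ker(ℤ[X] → ℤ[ℙ¹])`.
HONEST FRAMING: finite-field bookkeeping; nothing about SUPPLY, NUM, crux 23422 ∕ 19109 is proved here; BSD is proved for no curve. [folklore]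
-/

namespace Summit.BirchSwinnertonDyer.BirchSwinnertonDyer.Theorems.CartanSupply.CubicHecke

open Summit.BirchSwinnertonDyer.BirchSwinnertonDyer.Theorems.CartanDegree
open Summit.BirchSwinnertonDyer.BirchSwinnertonDyer.Theorems.CartanTorusCubeCut
open Summit.BirchSwinnertonDyer.BirchSwinnertonDyer.Theorems.CartanSupply.CubicClasses

set_option linter.dupNamespace false
set_option autoImplicit false

open scoped Classical

variable {q : ℕ} [Fact q.Prime]

/-! ## §1 The determinant pairing and non-zero cubes -/

/-- The determinant pairing `det(v | w)`. -/
def dt (v w : Fin 2 → ZMod q) : ZMod q := v 0 * w 1 - v 1 * w 0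

/-- PROVED: `det(w | v) = −det(v | w)`. [folklore] -/
theorem dt_swap (v w : Fin 2 → ZMod q) : dt w v = -dt v w := by unfold dt; ring

/-- PROVED: linearity in the first slot (scalars). [folklore] -/
theorem dt_smul_left (c : ZMod q) (v w : Fin 2 → ZMod q) : dt (c • v) w = c * dt v w := by
  unfold dt; simp only [Pi.smul_apply, smul_eq_mul]; ring

/-- PROVED: linearity in the second slot (scalars). [folklore] -/
theorem dt_smul_right (c : ZMod q) (v w : Fin 2 → ZMod q) : dt v (c • w) = c * dt v w := by
  unfold dt; simp only [Pi.smul_apply, smul_eq_mul]; ring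

/-- PROVED: `det(v | αv + βw) = β det(v | w)`. [folklore] -/
theorem dt_combo_right (v w : Fin 2 → ZMod q) (α β : ZMod q) : dt v (α • v + β • w) = β * dt v w := by
  unfold dt; simp only [Pi.add_apply, Pi.smul_apply, smul_eq_mul]; ring

/-- PROVED: `det(αv + βw | w) = α det(v | w)`. [folklore] -/
theorem dt_combo_left (v w : Fin 2 → ZMod q) (α β : ZMod q) : dt (α • v + β • w) w = α * dt v w := by
  unfold dt; simp only [Pi.add_apply, Pi.smul_apply, smul_eq_mul]; ring

/-- PROVED: `det(g v | g w) = det g · det(v | w)`. [folklore] -/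
theorem dt_mulVec (M : Mat q) (v w : Fin 2 → ZMod q) : dt (M.mulVec v) (M.mulVec w) = M.det * dt v w := by
  unfold dt
  rw [Matrix.det_fin_two]
  simp only [Matrix.mulVec, dotProduct, Fin.sum_univ_two]
  ring

/-- PROVED: `det(g ⋆ v | g ⋆ w) = (det g)³ det(v | w)`. [folklore] -/
theorem dt_actV (g : G q) (v w : V0 q) :
    dt (actV g v : Fin 2 → ZMod q) (actV g w) = (g : Mat q).det ^ 3 * dt (v : Fin 2 → ZMod q) w := by
  rw [coe_actV, coe_actV, dt_smul_left, dt_smul_right, dt_mulVec]; ring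

/-- `c` is a non-zero cube. -/
def IsCubeUnit (c : ZMod q) : Prop := ∃ w : ZMod q, w ≠ 0 ∧ w ^ 3 = c

/-- PROVED: a non-zero cube is non-zero. [folklore] -/
theorem IsCubeUnit.ne_zero {c : ZMod q} (h : IsCubeUnit c) : c ≠ 0 := by
  obtain ⟨w, hw, rfl⟩ := h; exact pow_ne_zero 3 hw

/-- PROVED: multiplying by a non-zero cube preserves (non-)cubes. [folklore] -/
theorem isCubeUnit_mul_iff {c d : ZMod q} (hc : IsCubeUnit c) : IsCubeUnit (c * d) ↔ IsCubeUnit d := by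
  obtain ⟨w, hw, rfl⟩ := hc
  constructor
  · rintro ⟨z, hz, h⟩
    refine ⟨z * w⁻¹, mul_ne_zero hz (inv_ne_zero hw), ?_⟩
    have : d = z ^ 3 * (w ^ 3)⁻¹ := by
      rw [h, mul_comm, ← mul_assoc, inv_mul_cancel₀ (pow_ne_zero 3 hw), one_mul]
    rw [this, mul_pow, inv_pow]
  · rintro ⟨z, hz, rfl⟩
    exact ⟨w * z, mul_ne_zero hw hz, by ring⟩

/-- PROVED: `−c` is a non-zero cube iff `c` is (`−1 = (−1)³`). [folklore] -/
theorem isCubeUnit_neg_iff (c : ZMod q) : IsCubeUnit (-c) ↔ IsCubeUnit c := by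
  have h1 : IsCubeUnit (-1 : ZMod q) := ⟨-1, neg_ne_zero.mpr one_ne_zero, by ring⟩
  rw [show -c = -1 * c by ring, isCubeUnit_mul_iff h1]

/-- PROVED: a unit is in `K` iff its value is a non-zero cube. [folklore] -/
theorem mem_cubes_iff_isCubeUnit (u : (ZMod q)ˣ) : u ∈ cubes q ↔ IsCubeUnit (u : ZMod q) := by
  rw [mem_cubes_iff_val]
  constructor
  · rintro ⟨w, hw⟩
    exact ⟨w, by rintro rfl; exact u.ne_zero (by rw [← hw]; ring), hw⟩
  · rintro ⟨w, -, hw⟩; exact ⟨w, hw⟩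

/-- PROVED: `#{c : IsCubeUnit c} = #K`. [folklore] -/
theorem card_cubeUnits : (Finset.univ.filter fun c : ZMod q => IsCubeUnit c).card = Nat.card (cubes q) := by
  rw [Nat.card_eq_fintype_card, ← Finset.card_univ]
  symm
  refine Finset.card_bij (fun k _ => ((k : (ZMod q)ˣ) : ZMod q)) (fun k _ => ?_) (fun k _ k' _ h => ?_) (fun c hc => ?_)
  · simp only [Finset.mem_filter, Finset.mem_univ, true_and]
    exact (mem_cubes_iff_isCubeUnit _).mp k.2
  · exact Subtype.ext (Units.ext h)
  · simp only [Finset.mem_filter, Finset.mem_univ, true_and] at hc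
    refine ⟨⟨Units.mk0 c hc.ne_zero, (mem_cubes_iff_isCubeUnit _).mpr (by simpa using hc)⟩, Finset.mem_univ _, rfl⟩

/-- PROVED: for `D ≠ 0`, `#{α : IsCubeUnit (α D)} = #K`. [folklore] -/
theorem card_cubeUnits_mul {D : ZMod q} (hD : D ≠ 0) :
    (Finset.univ.filter fun α : ZMod q => IsCubeUnit (α * D)).card = Nat.card (cubes q) := by
  rw [← card_cubeUnits]
  refine Finset.card_bij (fun α _ => α * D) (fun α hα => ?_) (fun α _ β _ h => mul_right_cancel₀ hD h) (fun c hc => ?_)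
  · simpa using hα
  · simp only [Finset.mem_filter, Finset.mem_univ, true_and] at hc
    exact ⟨c * D⁻¹, by simp [mul_assoc, inv_mul_cancel₀ hD, hc], by rw [mul_assoc, inv_mul_cancel₀ hD, mul_one]⟩

/-! ## §2 The Hecke relation on `X` -/

/-- PROVED: scaling the first vector by a cube does not change cube-ness of the pairing. [folklore] -/
theorem isCubeUnit_dt_scaleV_left {k : (ZMod q)ˣ} (hk : k ∈ cubes q) (v w : V0 q) :
    IsCubeUnit (dt (scaleV k v : Fin 2 → ZMod q) w) ↔ IsCubeUnit (dt (v : Fin 2 → ZMod q) w) := by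
  rw [coe_scaleV, dt_smul_left, isCubeUnit_mul_iff ((mem_cubes_iff_isCubeUnit k).mp hk)]

/-- PROVED: same on the right. [folklore] -/
theorem isCubeUnit_dt_scaleV_right {k : (ZMod q)ˣ} (hk : k ∈ cubes q) (v w : V0 q) :
    IsCubeUnit (dt (v : Fin 2 → ZMod q) (scaleV k w)) ↔ IsCubeUnit (dt (v : Fin 2 → ZMod q) w) := by
  rw [coe_scaleV, dt_smul_right, isCubeUnit_mul_iff ((mem_cubes_iff_isCubeUnit k).mp hk)]

/-- The HECKE RELATION on `X`: `rel [v] [w] ⟺ det(v | w) ∈ K`. -/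
def rel : X q → X q → Prop :=
  Quotient.lift₂ (fun v w : V0 q => IsCubeUnit (dt (v : Fin 2 → ZMod q) w)) (fun v₁ w₁ v₂ w₂ hv hw => by
    obtain ⟨k, hk, rfl⟩ := mk_eq_mk_iff.mp (Quotient.sound hv : mk v₁ = mk v₂)
    obtain ⟨k', hk', rfl⟩ := mk_eq_mk_iff.mp (Quotient.sound hw : mk w₁ = mk w₂)
    exact propext (by rw [isCubeUnit_dt_scaleV_left hk, isCubeUnit_dt_scaleV_right hk']))

/-- PROVED: unfolding. [folklore] -/
theorem rel_mk (v w : V0 q) : rel (mk v) (mk w) ↔ IsCubeUnit (dt (v : Fin 2 → ZMod q) w) := Iff.rfl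

/-- PROVED: the relation is `G`-invariant. [folklore] -/
theorem rel_σX (g : G q) (x y : X q) : rel (σX g x) (σX g y) ↔ rel x y := by
  obtain ⟨v, rfl⟩ := mk_surjective x
  obtain ⟨w, rfl⟩ := mk_surjective y
  rw [σX_mk, σX_mk, rel_mk, rel_mk, dt_actV, isCubeUnit_mul_iff ⟨(g : Mat q).det, det_ne_zero g, rfl⟩]

/-- PROVED: scalings move across the relation. [folklore] -/
theorem rel_ρX (u : (ZMod q)ˣ) (x y : X q) : rel (ρX u x) y ↔ rel x (ρX u y) := by
  obtain ⟨v, rfl⟩ := mk_surjective x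
  obtain ⟨w, rfl⟩ := mk_surjective y
  rw [ρX_mk, ρX_mk, rel_mk, rel_mk, coe_scaleV, coe_scaleV, dt_smul_left, dt_smul_right]

/-- PROVED: the relation is symmetric. [folklore] -/
theorem rel_symm (x y : X q) : rel x y ↔ rel y x := by
  obtain ⟨v, rfl⟩ := mk_surjective x
  obtain ⟨w, rfl⟩ := mk_surjective y
  rw [rel_mk, rel_mk, dt_swap (v : Fin 2 → ZMod q) w, isCubeUnit_neg_iff]

/-- PROVED: related points lie in different fibres over `ℙ¹`. [folklore] -/
theorem toP1_ne_of_rel {x y : X q} (h : rel x y) : toP1 y ≠ toP1 x := by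
  intro he
  obtain ⟨u, rfl⟩ := (toP1_eq_toP1_iff x y).mp he
  obtain ⟨v, rfl⟩ := mk_surjective x
  rw [ρX_mk, rel_mk, coe_scaleV, dt_smul_right] at h
  apply h.ne_zero
  unfold dt; ring

/-! ## §3 The Hecke operator, the action and the scalings on functions -/

section operators
variable (A : Type*) [CommRing A]

/-- The adjacency matrix of the Hecke relation. -/
noncomputable def adj (x y : X q) : A := if rel x y then 1 else 0

/-- The HECKE OPERATOR `(T φ)(x) = Σ_{y : rel x y} φ(y)`. -/
noncomputable def hecke : (X q → A) →ₗ[A] (X q → A) where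
  toFun φ x := ∑ y, adj A x y * φ y
  map_add' φ ψ := by
    ext x
    simp only [Pi.add_apply, mul_add, Finset.sum_add_distrib]
  map_smul' c φ := by
    ext x
    simp only [Pi.smul_apply, smul_eq_mul, RingHom.id_apply, Finset.mul_sum]
    exact Finset.sum_congr rfl fun y _ => by ring

/-- PROVED: unfolding. [folklore] -/
theorem hecke_apply (φ : X q → A) (x : X q) : hecke A φ x = ∑ y, (if rel x y then φ y else 0) := by
  show ∑ y, adj A x y * φ y = _
  exact Finset.sum_congr rfl fun y _ => by unfold adj; split_ifs <;> simp

/-- The action of `g` on functions: `(act g φ)(x) = φ(g⁻¹ ⋆ x)`. -/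
noncomputable def act (g : G q) : (X q → A) →ₗ[A] (X q → A) := LinearMap.funLeft A A (σX g⁻¹)

/-- PROVED: unfolding. [folklore] -/
theorem act_apply (g : G q) (φ : X q → A) (x : X q) : act A g φ x = φ (σX g⁻¹ x) := rfl

/-- The scaling `(sc u φ)(x) = φ(ρ_{u⁻¹} x)`. -/
noncomputable def sc (u : (ZMod q)ˣ) : (X q → A) →ₗ[A] (X q → A) := LinearMap.funLeft A A (ρX u⁻¹)

/-- PROVED: unfolding. [folklore] -/
theorem sc_apply (u : (ZMod q)ˣ) (φ : X q → A) (x : X q) : sc A u φ x = φ (ρX u⁻¹ x) := rfl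

/-- PROVED: `act` is multiplicative. [folklore] -/
theorem act_mul (g h : G q) : act A (g * h) = act A g ∘ₗ act A h := by
  refine LinearMap.ext fun φ => funext fun x => ?_
  simp only [act_apply, LinearMap.coe_comp, Function.comp_apply, mul_inv_rev, map_mul, Equiv.Perm.mul_apply]

/-- PROVED: `act 1 = id`. [folklore] -/
theorem act_one : act A (1 : G q) = LinearMap.id := by
  refine LinearMap.ext fun φ => funext fun x => ?_
  simp only [act_apply, inv_one, map_one, Equiv.Perm.one_apply, LinearMap.id_apply]

/-- PROVED: `sc` is multiplicative. [folklore] -/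
theorem sc_mul (u w : (ZMod q)ˣ) : sc A (u * w) = sc A u ∘ₗ sc A w := by
  refine LinearMap.ext fun φ => funext fun x => ?_
  simp only [sc_apply, LinearMap.coe_comp, Function.comp_apply, mul_inv_rev, ρX_mul, Equiv.Perm.mul_apply]

/-- PROVED: cubes scale trivially. [folklore] -/
theorem sc_of_mem {k : (ZMod q)ˣ} (hk : k ∈ cubes q) : sc A k = (LinearMap.id : (X q → A) →ₗ[A] (X q → A)) := by
  refine LinearMap.ext fun φ => funext fun x => ?_
  rw [sc_apply, ρX_of_mem ((cubes q).inv_mem hk), Equiv.Perm.one_apply, LinearMap.id_apply]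

/-- PROVED: the scalings commute with the action. [folklore] -/
theorem act_comp_sc (g : G q) (u : (ZMod q)ˣ) : act A g ∘ₗ sc A u = sc A u ∘ₗ act A g := by
  refine LinearMap.ext fun φ => funext fun x => ?_
  simp only [LinearMap.coe_comp, Function.comp_apply, act_apply, sc_apply]
  rw [← Equiv.Perm.mul_apply, ← Equiv.Perm.mul_apply, σX_ρX_comm]

/-- PROVED — **EQUIVARIANCE**: `T ∘ act g = act g ∘ T`. [folklore] -/
theorem hecke_comp_act (g : G q) : hecke A ∘ₗ act A g = act A g ∘ₗ (hecke A : (X q → A) →ₗ[A] (X q → A)) := by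
  refine LinearMap.ext fun φ => funext fun x => ?_
  simp only [LinearMap.coe_comp, Function.comp_apply, hecke_apply, act_apply]
  -- reindex `y = σX g z`
  rw [← Equiv.sum_comp (σX g) (fun y => if rel x y then φ (σX g⁻¹ y) else 0)]
  refine Finset.sum_congr rfl fun z _ => ?_
  have h1 : σX g⁻¹ (σX g z) = z := by rw [← Equiv.Perm.mul_apply, ← map_mul, inv_mul_cancel, map_one, Equiv.Perm.one_apply]
  have h2 : rel x (σX g z) ↔ rel (σX g⁻¹ x) z := by
    conv_lhs => rw [show x = σX g (σX g⁻¹ x) by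
      rw [← Equiv.Perm.mul_apply, ← map_mul, mul_inv_cancel, map_one, Equiv.Perm.one_apply]]
    exact rel_σX g _ _
  simp only [h1, h2]

/-- PROVED — **SEMILINEARITY**: `T ∘ sc u = sc u⁻¹ ∘ T`. [folklore] -/
theorem hecke_comp_sc (u : (ZMod q)ˣ) : hecke A ∘ₗ sc A u = sc A u⁻¹ ∘ₗ (hecke A : (X q → A) →ₗ[A] (X q → A)) := by
  refine LinearMap.ext fun φ => funext fun x => ?_
  simp only [LinearMap.coe_comp, Function.comp_apply, hecke_apply, sc_apply, inv_inv]
  rw [← Equiv.sum_comp (ρX u) (fun y => if rel x y then φ (ρX u⁻¹ y) else 0)]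
  refine Finset.sum_congr rfl fun z _ => ?_
  have h1 : ρX u⁻¹ (ρX u z) = z := by rw [← Equiv.Perm.mul_apply, ← ρX_mul, inv_mul_cancel, ρX_one, Equiv.Perm.one_apply]
  have h2 : rel x (ρX u z) ↔ rel (ρX u x) z := (rel_ρX u x z).symm
  simp only [h1, h2]

end operators

/-! ## §4 Counting neighbours -/

/-- PROVED: for `v ≠ 0` every fibre of `w ↦ det(v | w)` has `q` elements. [folklore] -/
theorem card_dt_eq (v : V0 q) (c : ZMod q) : (Finset.univ.filter fun w : Fin 2 → ZMod q => dt (v : Fin 2 → ZMod q) w = c).card = q := by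
  -- a particular solution `w₀` with `det(v | w₀) = c`, then translate the kernel count
  have hv : (v : Fin 2 → ZMod q) ≠ 0 := v.2
  obtain ⟨w₀, hw₀⟩ : ∃ w₀ : Fin 2 → ZMod q, dt (v : Fin 2 → ZMod q) w₀ = c := by
    by_cases h0 : (v : Fin 2 → ZMod q) 0 = 0
    · have h1 : (v : Fin 2 → ZMod q) 1 ≠ 0 := by
        intro h1; apply hv; ext i; fin_cases i <;> simp [h0, h1]
      refine ⟨![-c * ((v : Fin 2 → ZMod q) 1)⁻¹, 0], ?_⟩
      unfold dt; simp [h0]; field_simp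
    · refine ⟨![0, c * ((v : Fin 2 → ZMod q) 0)⁻¹], ?_⟩
      unfold dt; simp; field_simp
  have hker := KernelCounts.card_collinear (v : Fin 2 → ZMod q) hv
  have hbij : (Finset.univ.filter fun w : Fin 2 → ZMod q => (v : Fin 2 → ZMod q) 0 * w 1 = (v : Fin 2 → ZMod q) 1 * w 0).card =
      (Finset.univ.filter fun w : Fin 2 → ZMod q => dt (v : Fin 2 → ZMod q) w = c).card := by
    refine Finset.card_bij (fun w _ => w + w₀) (fun w hw => ?_) (fun w _ w' _ h => add_right_cancel h) (fun w hw => ?_)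
    · simp only [Finset.mem_filter, Finset.mem_univ, true_and] at hw ⊢
      unfold dt at hw₀ ⊢
      simp only [Pi.add_apply]
      linear_combination hw + hw₀
    · simp only [Finset.mem_filter, Finset.mem_univ, true_and] at hw
      refine ⟨w - w₀, ?_, sub_add_cancel w w₀⟩
      simp only [Finset.mem_filter, Finset.mem_univ, true_and, Pi.sub_apply]
      unfold dt at hw hw₀
      linear_combination hw - hw₀
  rw [← hbij, hker]

/-- PROVED: `#{w ∈ 𝔽_q² : det(v | w) ∈ K} = q · #K`. [folklore] -/
theorem card_dt_cube (v : V0 q) :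
    (Finset.univ.filter fun w : Fin 2 → ZMod q => IsCubeUnit (dt (v : Fin 2 → ZMod q) w)).card = q * Nat.card (cubes q) := by
  rw [Finset.card_eq_sum_card_fiberwise (f := fun w : Fin 2 → ZMod q => dt (v : Fin 2 → ZMod q) w)
    (t := Finset.univ.filter fun c : ZMod q => IsCubeUnit c)]
  · have : ∀ c ∈ Finset.univ.filter (fun c : ZMod q => IsCubeUnit c),
        ((Finset.univ.filter fun w : Fin 2 → ZMod q => IsCubeUnit (dt (v : Fin 2 → ZMod q) w)).filter
          fun w => dt (v : Fin 2 → ZMod q) w = c).card = q := by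
      intro c hc
      simp only [Finset.mem_filter, Finset.mem_univ, true_and] at hc
      have hset : ((Finset.univ.filter fun w : Fin 2 → ZMod q => IsCubeUnit (dt (v : Fin 2 → ZMod q) w)).filter
          fun w => dt (v : Fin 2 → ZMod q) w = c) = Finset.univ.filter fun w : Fin 2 → ZMod q => dt (v : Fin 2 → ZMod q) w = c := by
        ext w
        simp only [Finset.mem_filter, Finset.mem_univ, true_and]
        exact ⟨fun h => h.2, fun h => ⟨h ▸ hc, h⟩⟩
      rw [hset]
      exact card_dt_eq v c
    rw [Finset.sum_congr rfl this, Finset.sum_const, smul_eq_mul, card_cubeUnits, mul_comm]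
  · intro w hw
    simpa using hw

/-- PROVED — **DEGREE `q`**: every point has exactly `q` Hecke neighbours. [folklore] -/
theorem card_rel_eq (x : X q) : (Finset.univ.filter fun y : X q => rel x y).card = q := by
  obtain ⟨v, rfl⟩ := mk_surjective x
  have hK : 0 < Nat.card (cubes q) := Nat.card_pos
  apply Nat.eq_of_mul_eq_mul_left hK
  rw [← card_filter_V0_eq (fun y => rel (mk v) y)]
  have h1 : (Finset.univ.filter fun w : V0 q => rel (mk v) (mk w)) =
      Finset.univ.filter fun w : V0 q => IsCubeUnit (dt (v : Fin 2 → ZMod q) w) :=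
    Finset.filter_congr (fun w _ => rel_mk v w)
  have h2 : (Finset.univ.filter fun w : Fin 2 → ZMod q => w ≠ 0 ∧ IsCubeUnit (dt (v : Fin 2 → ZMod q) w)) =
      Finset.univ.filter fun w : Fin 2 → ZMod q => IsCubeUnit (dt (v : Fin 2 → ZMod q) w) := by
    apply Finset.filter_congr
    intro w _
    refine ⟨fun h => h.2, fun h => ⟨?_, h⟩⟩
    rintro rfl
    apply h.ne_zero
    unfold dt; simp
  rw [h1, ← card_filter_ne_zero_eq (fun w => IsCubeUnit (dt (v : Fin 2 → ZMod q) w)), h2, card_dt_cube, mul_comm]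

end Summit.BirchSwinnertonDyer.BirchSwinnertonDyer.Theorems.CartanSupply.CubicHecke
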